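/-
Origin: expansion seat `prover-pub-hodgecm-mc-sinst-1-g11-0`, handover #1261 2026-08-21T02:25Z md5 d8bd63263878 (357 l.; NEW additive leaf, ns HodgeCM.Model.ThetaAdelicSide, slot 0 at splitLineZeroTwisted/charZeroDict of #1256: adelicLinePairEquiv_adelicInr_eq_cmCenter (1 ⊗ w ↦ (det w) · 1_V), twistCharW_bigCharZero_eq (twistCharW ĉ₀ = adelicCharZero ∘ CMCenter (frameD V) ∘ finLineTorus), adelicCharZero_cmCenter_symm_eq_one, twistCharW_bigCharZero_rationalToFinAdelic, chiZero_rationalToFinAdelic, cWZero_eq_torusScalar_zeroG_finLineTorus, torusScalar_zeroG_symm_eq_one (tree char₃_eq_one_of_rational), cWZero_rationalToFinAdelic, psiZero_rationalToFinAdelic, charZeroDict_rationalToFinAdelic (ψ₀(γ_f) = adelicCharZero(centre_V u_{t_γ})⁻¹ · (χ(♯(t_γ,1_f)) · torusScalar_zeroG(u_{t_γ}))), hasRationalRestriction_charZeroDict_one (hχinf : ∀ t, χ(♯(t,1_f)) · torusScalar_zeroG(u_t) = adelicCharZero(centre_V u_t)) + _of_weight (hw : w t · adelicCharZero(centre_V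 u_t) = torusScalar_zeroG(u_t)), continuous_chiZero(_val), continuous_torusScalar_zeroG_val, continuous_adelicCharZero_val, continuous_cWZero, continuous_twistCharW_bigCharZero, continuous_charZeroDict, isLevelTrivial_charZeroDict (UNCONDITIONAL), isAutChar_charZeroDict, isAutChar_charZeroDict_of_weight; NAMES for audit: HodgeCM.Model.ThetaAdelicSide.twistCharW_bigCharZero_eq · HodgeCM.Model.ThetaAdelicSide.charZeroDict_rationalToFinAdelic · HodgeCM.Model.ThetaAdelicSide.isAutChar_charZeroDict) (`HOME/mc/pub-hodgecm-mc-sinst-1-g11/stage70/HodgeCM/Model/AdelicThetaDistributionAutZero.lean`, md5 d8bd63263878, 357 lines);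
landed by the second packager p2 gen 17 (p2-g17) in gate run 70 as `HodgeCM/Model/AdelicThetaDistributionAutZero.lean` (verbatim).
-/
/-
Copyright (c) 2026 the pub-hodgecm formalisation cell (harness21).  New file, not vendored.
Origin: session prover-pub-hodgecm-mc-sinst-1-g11-0 (unit pub-hodgecm-mc-sinst-1-g11, S-INSTANCE CONSTRUCTOR gen 11; the AUTOMORPHY of the
slot-0 dictionary character `charZeroDict` (#1256) on the twisted record `splitLineZeroTwisted` — binder-2's socket hypothesis `hχ` for slot 0),
2026-08-21.
Intended final place: `HodgeCM/Model/AdelicThetaDistributionAutZero.lean` (NEW additive model-layer leaf; imports sinst-1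
`Model/AdelicThetaDistributionAut` (slot 1 + the rational-point bookkeeping); nothing imports it; drop alone).
-/
import Summits.HodgeConjecture.HodgeCM.Model.AdelicThetaDistributionAut_2

set_option autoImplicit false

/-!
# The slot-0 dictionary character `ψ₀ = charZeroDict χ` is automorphic ON THE WEIGHT SET, modulo one archimedean identity

Slot 0 of the honest side lands in the dictionary through the TWISTED record `splitLineZeroTwisted = splitLineZero ⊗ ĉ₀` (#1256), with
character `ψ₀ := charZeroDict χ = twistCharW ĉ₀ · chiZero χ · cWZero⁻¹`.  As for slot 1 (`Model/AdelicThetaDistributionAut`):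
* § 3a `adelicLinePairEquiv_adelicInr_eq_cmCenter` (`1 ⊗ w ↦ (det w) · 1_V`), **`twistCharW_bigCharZero_eq`** (`twistCharW ĉ₀ =
  adelicCharZero ∘ centre_V ∘ finLineTorus`), `twistCharW_bigCharZero_rationalToFinAdelic` (`= adelicCharZero((t_γ,1_f) · 1_V)⁻¹` on a rational
  point: `adelicCharZero_eq_one_of_rat` + centre rationality);
* § 3b `chiZero_/cWZero_/psiZero_rationalToFinAdelic`, **`charZeroDict_rationalToFinAdelic`**:
  `ψ₀(γ_f) = adelicCharZero((t_γ,1_f) · 1_V)⁻¹ · χ(♯(t_γ,1_f)) · torusScalar_zeroG(u_{t_γ})` — an ARCHIMEDEAN quantity;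
* § 3c **`hasRationalRestriction_charZeroDict_one`** under the ONE archimedean identity
  `hχinf : ∀ t, χ(♯(t,1_f)) · torusScalar_zeroG(u_t) = adelicCharZero((t,1_f) · 1_V)` — for `χ` on the slot's weight set (`χ(♯(t,1_f)) · w₀ t = 1`)
  this is **(Hw₀) `w₀ t · adelicCharZero((t,1_f) · 1_V) = torusScalar_zeroG(u_t)`** («the archimedean CENTRE of `U(V)` acts trivially on the
  slot-0 archimedean vector»; theta-3's `hasCentralTypeAt_twistBy_iff` in #S16 r2 types the same identity), `…_of_weight`;
* § 3d **`isLevelTrivial_charZeroDict`** UNCONDITIONALLY (continuity from `hηc` and the sign facts), **`isAutChar_charZeroDict`** (+ `_of_weight`).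
KERNEL only: 0 records, 0 `def … : Prop`, nothing cited as a hypothesis; `#print axioms` ⊆ {propext, Classical.choice, Quot.sound}.
-/

noncomputable section

open MulAction IsDedekindDomain NumberField.mixedEmbedding
open NumberField hiding relNormOneIdeles relNormOneRat probHaarRelNormOneQuot relNormOneInfUnits relNormOneInfToIdeles
open scoped Matrix TensorProduct Classical SchwartzMap
open Literature.NumberTheory.Automorphic Literature.NumberTheory.Weil1964
open Literature.NumberTheory.GelbartRogawski1991 Literature.NumberTheory.GelbartRogawski1991.UnitaryDualPair
open Literature.RepresentationTheory (SeesawScalar.twist SeesawScalar.twist_apply)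
open Literature.Geometry.ComplexHyperbolic.BallModel (U21 x₀)
open Literature.AlgebraicGeometry.ShimuraVarieties
open HodgeCM.Adelic HodgeCM.PerL34 HodgeCM.Model.ArchSideTerm HodgeCM.Model.ThetaDistFin
open Literature.NumberTheory.Automorphic.UnitaryGroup (cmAdelicOneEquivRelNormOne)

namespace HodgeCM.Model
namespace ThetaAdelicSide

variable {L : CMField} {ι₁ : L →+* ℂ} (V : HermSpace3 L ι₁) (c : SeesawCtx L)
  (hGR : (cmSplittingDatum (L : Type) finProdFinEquiv (frameD V) (frameD_real V) (frameD_ne V) (dW c.D) (dW_real c.D)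
    (dW_ne c.D)).CompatibleSplitting)
  (hGR₀ : (cmSplittingDatum (L : Type) (e₁) (frameD V) (frameD_real V) (frameD_ne V) (lineVec (L : Type) (dW c.D 0))
    (fun _ => dW_real c.D 0) (fun _ => dW_ne c.D 0)).CompatibleSplitting)
  (hGR₁ : (cmSplittingDatum (L : Type) (e₁) (frameD V) (frameD_real V) (frameD_ne V) (lineVec (L : Type) (dW c.D 1))
    (fun _ => dW_real c.D 1) (fun _ => dW_ne c.D 1)).CompatibleSplitting)
  (η : CMAdelic (L : Type) (frameD V) × CMAdelic (L : Type) (dW c.D) →* ℂˣ)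
  (hη : ∀ γU ∈ CMRat (L : Type) (frameD V), ∀ γ ∈ CMRat (L : Type) (dW c.D), η (γU, γ) = 1)
  (hηc : Continuous fun p => ((η p : ℂˣ) : ℂ))
  (h₁W : (∀ j, 0 < (ι₁ (dW c.D j)).re) ∨ ∀ j, (ι₁ (dW c.D j)).re < 0)
  (χ : PontryaginDual (↥(relNormOneIdeles (↥(maximalRealSubfield L)) L) ⧸ relNormOneRat (↥(maximalRealSubfield L)) L))

/-! ## § 3. Slot 0: `ψ₀ = charZeroDict χ` on the twisted record `splitLineZeroTwisted` -/

/-! ### § 3a. The W-part of the big character `ĉ₀` -/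

/-- the line identification `G₁(𝔸) ≃ U(diag frameD V)(𝔸)` of #1255 takes `1 ⊗ w` to the CENTRE element `(det w) · 1_V`. -/
theorem adelicLinePairEquiv_adelicInr_eq_cmCenter (w : CMAdelic (L : Type) (lineVec (L : Type) (dW c.D 0))) :
    LinePair.adelicLinePairEquiv (↥(maximalRealSubfield L)) (L : Type) (IsCMField.complexConj L) 3 (Matrix.diagonal (frameD V))
        (Matrix.diagonal (lineVec (L : Type) (dW c.D 0))) (lineVec_dW_zero_ne c)
        (UnitaryGroup.adelicInr (↥(maximalRealSubfield L)) (L : Type) (IsCMField.complexConj L) 3 1 (Matrix.diagonal (frameD V))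
          (Matrix.diagonal (lineVec (L : Type) (dW c.D 0))) w) =
      CMCenter (L : Type) (frameD V) (cmAdelicDet (L : Type) (lineVec (L : Type) (dW c.D 0)) (fun _ => dW_ne c.D 0) w) := by
  apply Subtype.ext
  apply Units.ext
  rw [LinePair.coe_adelicLinePairEquiv_adelicInr, UnitaryGroup.coe_adelicCenter, coe_cmAdelicDet, Matrix.GeneralLinearGroup.val_det_apply,
    Matrix.det_unique]

/-- **`twistCharW ĉ₀ u = adelicCharZero ((det (1_∞, u)) · 1_V)`**: the `W`-part of the big character of slot 0 is the adelic `V`-character of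
slot 0 on the centre. -/
theorem twistCharW_bigCharZero_eq (u : UfZero c.D) :
    HodgeCM.WeilCoinv.twistCharW (↥(maximalRealSubfield L)) (L : Type) (IsCMField.complexConj L) 3 1
        (Matrix.diagonal (frameD V)) (splitLineZero V c hGR₀).JW (bigCharZero V c hGR hGR₀ hGR₁ η) u =
      adelicCharZero V c hGR hGR₀ hGR₁ η (CMCenter (L : Type) (frameD V) (finLineTorus (L : Type) (dW c.D 0) (dW_ne c.D 0) u)) := by
  show HodgeCM.WeilCoinv.twistCharW (↥(maximalRealSubfield L)) (L : Type) (IsCMField.complexConj L) 3 1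
      (Matrix.diagonal (frameD V)) (Matrix.diagonal (lineVec (L : Type) (dW c.D 0))) (bigCharZero V c hGR hGR₀ hGR₁ η) u = _
  rw [bigCharZero, LinePair.twistCharW_bigCharOfV_apply, adelicLinePairEquiv_adelicInr_eq_cmCenter, finLineTorus_apply]

include hη in
/-- `adelicCharZero` is trivial on the RATIONAL centre (`adelicCharZero_eq_one_of_rat` of #1256 + centre rationality). -/
theorem adelicCharZero_cmCenter_symm_eq_one {t₀ : ↥(relNormOneIdeles (↥(maximalRealSubfield L)) L)}
    (ht₀ : t₀ ∈ relNormOneRat (↥(maximalRealSubfield L)) L) :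
    adelicCharZero V c hGR hGR₀ hGR₁ η (CMCenter (L : Type) (frameD V) ((cmAdelicOneEquivRelNormOne (L : Type)).symm t₀)) = 1 :=
  adelicCharZero_eq_one_of_rat V c hGR hGR₀ hGR₁ η hη
    (UnitaryGroup.cm_adelicCenter_symm_mem_range_toAdelic (L : Type) 3 (Matrix.diagonal (frameD V)) t₀ ht₀)

include hη in
/-- **`twistCharW ĉ₀ (γ_f) = adelicCharZero((t_γ, 1_f) · 1_V)⁻¹`** on a rational point. -/
theorem twistCharW_bigCharZero_rationalToFinAdelic
    (γ : ↥(UnitaryGroup.rational (↥(maximalRealSubfield L)) (L : Type) (IsCMField.complexConj L) 1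
      (Matrix.diagonal (lineVec (L : Type) (dW c.D 0))))) :
    HodgeCM.WeilCoinv.twistCharW (↥(maximalRealSubfield L)) (L : Type) (IsCMField.complexConj L) 3 1
        (Matrix.diagonal (frameD V)) (splitLineZero V c hGR₀).JW (bigCharZero V c hGR hGR₀ hGR₁ η)
        (UnitaryGroup.rationalToFinAdelic (↥(maximalRealSubfield L)) (L : Type) (IsCMField.complexConj L) 1
          (Matrix.diagonal (lineVec (L : Type) (dW c.D 0))) γ) =
      (adelicCharZero V c hGR hGR₀ hGR₁ η (CMCenter (L : Type) (frameD V) (ratInfOne (L : Type) (dW c.D 0) (dW_ne c.D 0) γ)))⁻¹ := by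
  rw [twistCharW_bigCharZero_eq, finLineTorus_rationalToFinAdelic, map_mul, map_inv, map_mul, map_inv,
    adelicCharZero_cmCenter_symm_eq_one V c hGR hGR₀ hGR₁ η hη (ratDetIdele_mem_relNormOneRat (L : Type) (dW c.D 0) (dW_ne c.D 0) γ),
    mul_one]
  rfl

/-! ### § 3b. The values of `chiZero`, `cWZero`, `psiZero`, `charZeroDict` on rational points -/

/-- `chiZero χ (γ_f) = χ(♯(t_γ, 1_f))`. -/
theorem chiZero_rationalToFinAdelic
    (γ : ↥(UnitaryGroup.rational (↥(maximalRealSubfield L)) (L : Type) (IsCMField.complexConj L) 1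
      (Matrix.diagonal (lineVec (L : Type) (dW c.D 0))))) :
    chiZero c χ (UnitaryGroup.rationalToFinAdelic (↥(maximalRealSubfield L)) (L : Type) (IsCMField.complexConj L) 1
        (Matrix.diagonal (lineVec (L : Type) (dW c.D 0))) γ) =
      Circle.toUnits (χ (QuotientGroup.mk
        (relNormOneInfToIdeles (↥(maximalRealSubfield L)) L (ratInfPart (L : Type) (dW c.D 0) (dW_ne c.D 0) γ)))) := by
  rw [chiZero]
  simp only [MonoidHom.coe_comp, Function.comp_apply, QuotientGroup.mk'_apply, invMonoidHom_apply,
    mk_finLineTorusIdeles_rationalToFinAdelic, map_inv, inv_inv, MonoidHom.coe_coe]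

/-- `cWZero = torusScalar_zeroG ∘ finLineTorus`. -/
theorem cWZero_eq_torusScalar_zeroG_finLineTorus (u : UfZero c.D) :
    cWZero V c hGR hGR₀ hGR₁ η u =
      torusScalar_zeroG V c.D hGR hGR₀ hGR₁ (eta₀ V c.D η) (finLineTorus (L : Type) (dW c.D 0) (dW_ne c.D 0) u) := by
  rw [cWZero_apply, finCharZero_apply, finPairD_apply, map_one, map_one, torusScalar_zero_applyG, cmCenter_finLineTorus]
  rfl

include hη in
/-- the torus scalar of line 0 is trivial on RATIONAL points (`η₀` by `hη` through `cmEta₀_eq_one_of_rat`; `χ₀ = λ_V′ ⊠ λ₃` by [Weil1964, Thm 6]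
through the tree's `char₃_eq_one_of_rational`). -/
theorem torusScalar_zeroG_symm_eq_one {t₀ : ↥(relNormOneIdeles (↥(maximalRealSubfield L)) L)}
    (ht₀ : t₀ ∈ relNormOneRat (↥(maximalRealSubfield L)) L) :
    torusScalar_zeroG V c.D hGR hGR₀ hGR₁ (eta₀ V c.D η) ((cmAdelicOneEquivRelNormOne (L : Type)).symm t₀) = 1 := by
  have hη0 : eta₀ V c.D η (1, (cmAdelicOneEquivRelNormOne (L : Type)).symm t₀) = 1 :=
    cmEta₀_eq_one_of_rat (L : Type) (frameD V) (dW c.D) η hη (one_mem _) ht₀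
  obtain ⟨γ₀, hγ₀⟩ := UnitaryGroup.cm_adelicCenter_symm_mem_range_toAdelic (L : Type) 1
    (Matrix.diagonal (lineVec (L : Type) (dW c.D 0))) t₀ ht₀
  have hχ0 : cmLineChar₀ (L : Type) finProdFinEquiv e₁ (frameD V) (frameD_real V) (frameD_ne V) (dW c.D) (dW_real c.D) (dW_ne c.D)
      hGR hGR₀ hGR₁ (1, CMCenter (L : Type) (lineVec (L : Type) (dW c.D 0)) ((cmAdelicOneEquivRelNormOne (L : Type)).symm t₀)) = 1 := by
    rw [cmLineChar₀]
    simp only [MonoidHom.mul_apply, MonoidHom.coe_comp, Function.comp_apply, MonoidHom.coe_fst, MonoidHom.coe_snd, map_one, one_mul]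
    apply char₃_eq_one_of_rational
    · exact ratIsometry_one_lineVec (L : Type) (dW c.D)
    · exact ⟨γ₀, hγ₀⟩
  rw [torusScalar_zero_applyG, hη0, hχ0, mul_one]

include hη in
/-- `cWZero (γ_f) = torusScalar_zeroG(u_{t_γ})⁻¹`. -/
theorem cWZero_rationalToFinAdelic
    (γ : ↥(UnitaryGroup.rational (↥(maximalRealSubfield L)) (L : Type) (IsCMField.complexConj L) 1
      (Matrix.diagonal (lineVec (L : Type) (dW c.D 0))))) :
    cWZero V c hGR hGR₀ hGR₁ η (UnitaryGroup.rationalToFinAdelic (↥(maximalRealSubfield L)) (L : Type) (IsCMField.complexConj L) 1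
        (Matrix.diagonal (lineVec (L : Type) (dW c.D 0))) γ) =
      (torusScalar_zeroG V c.D hGR hGR₀ hGR₁ (eta₀ V c.D η) (ratInfOne (L : Type) (dW c.D 0) (dW_ne c.D 0) γ))⁻¹ := by
  rw [cWZero_eq_torusScalar_zeroG_finLineTorus, finLineTorus_rationalToFinAdelic, map_mul, map_inv,
    torusScalar_zeroG_symm_eq_one V c hGR hGR₀ hGR₁ η hη (ratDetIdele_mem_relNormOneRat (L : Type) (dW c.D 0) (dW_ne c.D 0) γ),
    mul_one]
  rfl

include hη in
/-- `ψ₀′(γ_f) = χ(♯(t_γ, 1_f)) · torusScalar_zeroG(u_{t_γ})` (`ψ₀′ = psiZero χ`, the untwisted W-character of slot 0). -/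
theorem psiZero_rationalToFinAdelic
    (γ : ↥(UnitaryGroup.rational (↥(maximalRealSubfield L)) (L : Type) (IsCMField.complexConj L) 1
      (Matrix.diagonal (lineVec (L : Type) (dW c.D 0))))) :
    psiZero V c hGR hGR₀ hGR₁ η χ (UnitaryGroup.rationalToFinAdelic (↥(maximalRealSubfield L)) (L : Type) (IsCMField.complexConj L) 1
        (Matrix.diagonal (lineVec (L : Type) (dW c.D 0))) γ) =
      Circle.toUnits (χ (QuotientGroup.mk
          (relNormOneInfToIdeles (↥(maximalRealSubfield L)) L (ratInfPart (L : Type) (dW c.D 0) (dW_ne c.D 0) γ)))) *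
        torusScalar_zeroG V c.D hGR hGR₀ hGR₁ (eta₀ V c.D η) (ratInfOne (L : Type) (dW c.D 0) (dW_ne c.D 0) γ) := by
  rw [psiZero, MonoidHom.mul_apply, MonoidHom.inv_apply, chiZero_rationalToFinAdelic, cWZero_rationalToFinAdelic V c hGR hGR₀ hGR₁ η hη,
    inv_inv]

include hη in
/-- **`ψ₀(γ_f) = adelicCharZero((t_γ,1_f) · 1_V)⁻¹ · χ(♯(t_γ, 1_f)) · torusScalar_zeroG(u_{t_γ})`** — the value of the slot-0 dictionary
character on a rational point; an ARCHIMEDEAN quantity. -/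
theorem charZeroDict_rationalToFinAdelic
    (γ : ↥(UnitaryGroup.rational (↥(maximalRealSubfield L)) (L : Type) (IsCMField.complexConj L) 1
      (Matrix.diagonal (lineVec (L : Type) (dW c.D 0))))) :
    charZeroDict V c hGR hGR₀ hGR₁ η χ (UnitaryGroup.rationalToFinAdelic (↥(maximalRealSubfield L)) (L : Type)
        (IsCMField.complexConj L) 1 (Matrix.diagonal (lineVec (L : Type) (dW c.D 0))) γ) =
      (adelicCharZero V c hGR hGR₀ hGR₁ η (CMCenter (L : Type) (frameD V) (ratInfOne (L : Type) (dW c.D 0) (dW_ne c.D 0) γ)))⁻¹ *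
        (Circle.toUnits (χ (QuotientGroup.mk
            (relNormOneInfToIdeles (↥(maximalRealSubfield L)) L (ratInfPart (L : Type) (dW c.D 0) (dW_ne c.D 0) γ)))) *
          torusScalar_zeroG V c.D hGR hGR₀ hGR₁ (eta₀ V c.D η) (ratInfOne (L : Type) (dW c.D 0) (dW_ne c.D 0) γ)) := by
  rw [charZeroDict, MonoidHom.mul_apply, twistCharW_bigCharZero_rationalToFinAdelic V c hGR hGR₀ hGR₁ η hη]
  exact congrArg _ (psiZero_rationalToFinAdelic V c hGR hGR₀ hGR₁ η hη χ γ)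

/-! ### § 3c. Rational triviality from ONE archimedean identity -/

include hη in
/-- **`ψ₀` IS TRIVIAL ON `U(⟨a₀⟩)(L⁺)`** as soon as `χ(♯(t,1_f)) · torusScalar_zeroG(u_t) = adelicCharZero((t,1_f) · 1_V)` on the archimedean
torus (for `χ` on the slot's weight set: (Hw₀) `w₀ t · adelicCharZero((t,1_f) · 1_V) = torusScalar_zeroG(u_t)`, «the archimedean centre of `U(V)`
acts trivially on the slot's archimedean vector»). -/
theorem hasRationalRestriction_charZeroDict_one
    (hχinf : ∀ t : ↥(relNormOneInfUnits (↥(maximalRealSubfield L)) L),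
      ((χ (QuotientGroup.mk (relNormOneInfToIdeles (↥(maximalRealSubfield L)) L t)) : Circle) : ℂ) *
          ((torusScalar_zeroG V c.D hGR hGR₀ hGR₁ (eta₀ V c.D η)
            ((cmAdelicOneEquivRelNormOne (L : Type)).symm (relNormOneInfToIdeles (↥(maximalRealSubfield L)) L t)) : ℂˣ) : ℂ) =
        ((adelicCharZero V c hGR hGR₀ hGR₁ η (CMCenter (L : Type) (frameD V)
            ((cmAdelicOneEquivRelNormOne (L : Type)).symm (relNormOneInfToIdeles (↥(maximalRealSubfield L)) L t))) : ℂˣ) : ℂ)) :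
    (splitLineZeroTwisted V c hGR hGR₀ hGR₁ η hη).HasRationalRestriction (charZeroDict V c hGR hGR₀ hGR₁ η χ) 1 := by
  rw [SplitLine.hasRationalRestriction_iff]
  intro γ
  have h := charZeroDict_rationalToFinAdelic V c hGR hGR₀ hGR₁ η hη χ γ
  have hne : adelicCharZero V c hGR hGR₀ hGR₁ η (CMCenter (L : Type) (frameD V) (ratInfOne (L : Type) (dW c.D 0) (dW_ne c.D 0) γ)) *
      1 = adelicCharZero V c hGR hGR₀ hGR₁ η (CMCenter (L : Type) (frameD V) (ratInfOne (L : Type) (dW c.D 0) (dW_ne c.D 0) γ)) *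
        ((adelicCharZero V c hGR hGR₀ hGR₁ η (CMCenter (L : Type) (frameD V) (ratInfOne (L : Type) (dW c.D 0) (dW_ne c.D 0) γ)))⁻¹ *
          (Circle.toUnits (χ (QuotientGroup.mk
              (relNormOneInfToIdeles (↥(maximalRealSubfield L)) L (ratInfPart (L : Type) (dW c.D 0) (dW_ne c.D 0) γ)))) *
            torusScalar_zeroG V c.D hGR hGR₀ hGR₁ (eta₀ V c.D η) (ratInfOne (L : Type) (dW c.D 0) (dW_ne c.D 0) γ))) := by
    rw [mul_one, mul_inv_cancel_left]
    apply Units.ext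
    rw [Units.val_mul]
    exact (hχinf _).symm
  rw [MonoidHom.one_apply]
  exact h.trans (mul_left_cancel hne).symm

include hη in
/-- the same from the WEIGHT identity and (Hw₀). -/
theorem hasRationalRestriction_charZeroDict_one_of_weight (w : ↥(relNormOneInfUnits (↥(maximalRealSubfield L)) L) → ℂ)
    (hχw : ∀ t : ↥(relNormOneInfUnits (↥(maximalRealSubfield L)) L),
      ((χ (QuotientGroup.mk (relNormOneInfToIdeles (↥(maximalRealSubfield L)) L t)) : Circle) : ℂ) * w t = 1)
    (hw : ∀ t : ↥(relNormOneInfUnits (↥(maximalRealSubfield L)) L),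
      w t * ((adelicCharZero V c hGR hGR₀ hGR₁ η (CMCenter (L : Type) (frameD V)
            ((cmAdelicOneEquivRelNormOne (L : Type)).symm (relNormOneInfToIdeles (↥(maximalRealSubfield L)) L t))) : ℂˣ) : ℂ) =
        ((torusScalar_zeroG V c.D hGR hGR₀ hGR₁ (eta₀ V c.D η)
            ((cmAdelicOneEquivRelNormOne (L : Type)).symm (relNormOneInfToIdeles (↥(maximalRealSubfield L)) L t)) : ℂˣ) : ℂ)) :
    (splitLineZeroTwisted V c hGR hGR₀ hGR₁ η hη).HasRationalRestriction (charZeroDict V c hGR hGR₀ hGR₁ η χ) 1 := by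
  refine hasRationalRestriction_charZeroDict_one V c hGR hGR₀ hGR₁ η hη χ fun t => ?_
  have hw' := hw t
  have hχ' := hχw t
  -- `χ · τ = χ · (w · α) = (χ · w) · α = α`
  rw [← hw', ← mul_assoc, hχ', one_mul]


/-! ### § 3d. Level triviality (continuity) and `IsAutChar` for slot 0 -/

/-- the coinvariant character of slot 0 has continuous values. -/
theorem continuous_chiZero_val : Continuous fun u : UfZero c.D => ((chiZero c χ u : ℂˣ) : ℂ) := by
  have hf : Continuous (finLineTorusIdeles (L : Type) (dW c.D 0) (dW_ne c.D 0)) :=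
    (continuous_cmAdelicOneEquivRelNormOne (L : Type)).comp
      ((continuous_cmAdelicDet (L : Type) (lineVec (L : Type) (dW c.D 0)) fun _ => dW_ne c.D 0).comp
        (UnitaryGroup.continuous_finAdelicToAdelic _ _ _ _ _))
  show Continuous fun u : UfZero c.D =>
    ((((χ : ↥(relNormOneIdeles (↥(maximalRealSubfield L)) L) ⧸ relNormOneRat (↥(maximalRealSubfield L)) L →* Circle)
      (QuotientGroup.mk (finLineTorusIdeles (L : Type) (dW c.D 0) (dW_ne c.D 0) u)))⁻¹ : Circle) : ℂ)
  exact continuous_subtype_val.comp (((map_continuous χ).comp (QuotientGroup.continuous_mk.comp hf)).inv)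

/-- the coinvariant character of slot 0 is continuous (into `ℂˣ`). -/
theorem continuous_chiZero : Continuous (chiZero c χ) :=
  (chiZero c χ).continuous_of_continuous_units_val (continuous_chiZero_val c χ)

include hηc h₁W in
/-- carch's torus scalar of line 0 has continuous values (`hηc`; `χ₀ = λ_V′ ⊠ λ₃` continuous from the sign facts, #1208). -/
theorem continuous_torusScalar_zeroG_val :
    Continuous fun u : CMAdelicOne (L : Type) => ((torusScalar_zeroG V c.D hGR hGR₀ hGR₁ (eta₀ V c.D η) u : ℂˣ) : ℂ) := by
  have h1 : Continuous fun u : CMAdelicOne (L : Type) => ((eta₀ V c.D η (1, u) : ℂˣ) : ℂ) :=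
    (continuous_cmEta₀ (L : Type) (frameD V) (dW c.D) η hηc).comp (continuous_const.prodMk continuous_id)
  have h2 : Continuous fun u : CMAdelicOne (L : Type) =>
      ((cmLineChar₀ (L : Type) finProdFinEquiv e₁ (frameD V) (frameD_real V) (frameD_ne V) (dW c.D) (dW_real c.D) (dW_ne c.D) hGR hGR₀
        hGR₁ (1, CMCenter (L : Type) (lineVec (L : Type) (dW c.D 0)) u) : ℂˣ) : ℂ) :=
    (continuous_cmLineChar₀_of_signs (L : Type) finProdFinEquiv e₁ (frameD V) (frameD_real V) (frameD_ne V) (dW c.D) (dW_real c.D)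
        (dW_ne c.D) hGR hGR₀ hGR₁ ι₁ (frameD_sign_ι₁' V) h₁W (frameD_sign_of_ne V)).comp
      (continuous_const.prodMk (continuous_adelicCenter _ _ _ _ _))
  simp only [torusScalar_zero_applyG, Units.val_mul]
  exact h1.mul h2

include hηc h₁W in
/-- the adelic `V`-character of slot 0 has continuous values. -/
theorem continuous_adelicCharZero_val :
    Continuous fun v : CMAdelic (L : Type) (frameD V) => ((adelicCharZero V c hGR hGR₀ hGR₁ η v : ℂˣ) : ℂ) := by
  have h1 : Continuous fun v : CMAdelic (L : Type) (frameD V) => ((eta₀ V c.D η (v, 1) : ℂˣ) : ℂ) :=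
    (continuous_cmEta₀ (L : Type) (frameD V) (dW c.D) η hηc).comp (continuous_id.prodMk continuous_const)
  have h2 : Continuous fun v : CMAdelic (L : Type) (frameD V) =>
      ((cmLineChar₀ (L : Type) finProdFinEquiv e₁ (frameD V) (frameD_real V) (frameD_ne V) (dW c.D) (dW_real c.D) (dW_ne c.D) hGR hGR₀
        hGR₁ (v, 1) : ℂˣ) : ℂ) :=
    (continuous_cmLineChar₀_of_signs (L : Type) finProdFinEquiv e₁ (frameD V) (frameD_real V) (frameD_ne V) (dW c.D) (dW_real c.D)
        (dW_ne c.D) hGR hGR₀ hGR₁ ι₁ (frameD_sign_ι₁' V) h₁W (frameD_sign_of_ne V)).comp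
      (continuous_id.prodMk continuous_const)
  simp only [adelicCharZero_apply, Units.val_mul]
  exact h1.mul h2

include hηc h₁W in
/-- `cWZero` is continuous (into `ℂˣ`). -/
theorem continuous_cWZero : Continuous (cWZero V c hGR hGR₀ hGR₁ η) := by
  apply (cWZero V c hGR hGR₀ hGR₁ η).continuous_of_continuous_units_val
  have hf : Continuous (finLineTorus (L : Type) (dW c.D 0) (dW_ne c.D 0)) :=
    (continuous_cmAdelicDet (L : Type) (lineVec (L : Type) (dW c.D 0)) fun _ => dW_ne c.D 0).comp
      (UnitaryGroup.continuous_finAdelicToAdelic _ _ _ _ _)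
  simp only [cWZero_eq_torusScalar_zeroG_finLineTorus]
  exact (continuous_torusScalar_zeroG_val V c hGR hGR₀ hGR₁ η hηc h₁W).comp hf

include hηc h₁W in
/-- the `W`-part of `ĉ₀` is continuous (into `ℂˣ`). -/
theorem continuous_twistCharW_bigCharZero :
    Continuous (HodgeCM.WeilCoinv.twistCharW (↥(maximalRealSubfield L)) (L : Type) (IsCMField.complexConj L) 3 1
      (Matrix.diagonal (frameD V)) (splitLineZero V c hGR₀).JW (bigCharZero V c hGR hGR₀ hGR₁ η)) := by
  apply MonoidHom.continuous_of_continuous_units_val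
  have hf : Continuous (finLineTorus (L : Type) (dW c.D 0) (dW_ne c.D 0)) :=
    (continuous_cmAdelicDet (L : Type) (lineVec (L : Type) (dW c.D 0)) fun _ => dW_ne c.D 0).comp
      (UnitaryGroup.continuous_finAdelicToAdelic _ _ _ _ _)
  simp only [twistCharW_bigCharZero_eq]
  exact (continuous_adelicCharZero_val V c hGR hGR₀ hGR₁ η hηc h₁W).comp ((continuous_adelicCenter _ _ _ _ _).comp hf)

include hηc h₁W in
/-- `ψ₀` is continuous (into `ℂˣ`). -/
theorem continuous_charZeroDict : Continuous (charZeroDict V c hGR hGR₀ hGR₁ η χ) := by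
  show Continuous fun u =>
    HodgeCM.WeilCoinv.twistCharW (↥(maximalRealSubfield L)) (L : Type) (IsCMField.complexConj L) 3 1
        (Matrix.diagonal (frameD V)) (splitLineZero V c hGR₀).JW (bigCharZero V c hGR hGR₀ hGR₁ η) u *
      (chiZero c χ u * (cWZero V c hGR hGR₀ hGR₁ η u)⁻¹)
  exact (continuous_twistCharW_bigCharZero V c hGR hGR₀ hGR₁ η hηc h₁W).mul
    ((continuous_chiZero c χ).mul (continuous_cWZero V c hGR hGR₀ hGR₁ η hηc h₁W).inv)

include hηc h₁W in
/-- **`ψ₀` IS LEVEL-TRIVIAL** on the twisted record — unconditionally. -/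
theorem isLevelTrivial_charZeroDict :
    (splitLineZeroTwisted V c hGR hGR₀ hGR₁ η hη).IsLevelTrivial (charZeroDict V c hGR hGR₀ hGR₁ η χ) := by
  obtain ⟨n₀, hn₀, h⟩ := UnitaryGroup.exists_nat_forall_dvd_finCongruenceLevel_le_ker (charZeroDict V c hGR hGR₀ hGR₁ η χ)
    (continuous_charZeroDict V c hGR hGR₀ hGR₁ η hηc h₁W χ).continuousAt
  exact ⟨n₀, hn₀, fun k hk => h n₀ hn₀ (dvd_refl _) k hk⟩

include hηc h₁W in
/-- **`ψ₀ = charZeroDict χ` IS A `GoodChar` OF THE TWISTED SLOT-0 RECORD** (`IsAutChar`) as soon as the ONE archimedean identity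
`χ(♯(t,1_f)) · torusScalar_zeroG(u_t) = adelicCharZero((t,1_f) · 1_V)` holds — binder-2's socket hypothesis `hχ` for slot 0. -/
theorem isAutChar_charZeroDict
    (hχinf : ∀ t : ↥(relNormOneInfUnits (↥(maximalRealSubfield L)) L),
      ((χ (QuotientGroup.mk (relNormOneInfToIdeles (↥(maximalRealSubfield L)) L t)) : Circle) : ℂ) *
          ((torusScalar_zeroG V c.D hGR hGR₀ hGR₁ (eta₀ V c.D η)
            ((cmAdelicOneEquivRelNormOne (L : Type)).symm (relNormOneInfToIdeles (↥(maximalRealSubfield L)) L t)) : ℂˣ) : ℂ) =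
        ((adelicCharZero V c hGR hGR₀ hGR₁ η (CMCenter (L : Type) (frameD V)
            ((cmAdelicOneEquivRelNormOne (L : Type)).symm (relNormOneInfToIdeles (↥(maximalRealSubfield L)) L t))) : ℂˣ) : ℂ)) :
    (splitLineZeroTwisted V c hGR hGR₀ hGR₁ η hη).IsAutChar (charZeroDict V c hGR hGR₀ hGR₁ η χ) :=
  ⟨isLevelTrivial_charZeroDict V c hGR hGR₀ hGR₁ η hη hηc h₁W χ,
    hasRationalRestriction_charZeroDict_one V c hGR hGR₀ hGR₁ η hη χ hχinf⟩

include hηc h₁W in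
/-- the same from the WEIGHT identity and (Hw₀). -/
theorem isAutChar_charZeroDict_of_weight (w : ↥(relNormOneInfUnits (↥(maximalRealSubfield L)) L) → ℂ)
    (hχw : ∀ t : ↥(relNormOneInfUnits (↥(maximalRealSubfield L)) L),
      ((χ (QuotientGroup.mk (relNormOneInfToIdeles (↥(maximalRealSubfield L)) L t)) : Circle) : ℂ) * w t = 1)
    (hw : ∀ t : ↥(relNormOneInfUnits (↥(maximalRealSubfield L)) L),
      w t * ((adelicCharZero V c hGR hGR₀ hGR₁ η (CMCenter (L : Type) (frameD V)
            ((cmAdelicOneEquivRelNormOne (L : Type)).symm (relNormOneInfToIdeles (↥(maximalRealSubfield L)) L t))) : ℂˣ) : ℂ) =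
        ((torusScalar_zeroG V c.D hGR hGR₀ hGR₁ (eta₀ V c.D η)
            ((cmAdelicOneEquivRelNormOne (L : Type)).symm (relNormOneInfToIdeles (↥(maximalRealSubfield L)) L t)) : ℂˣ) : ℂ)) :
    (splitLineZeroTwisted V c hGR hGR₀ hGR₁ η hη).IsAutChar (charZeroDict V c hGR hGR₀ hGR₁ η χ) :=
  ⟨isLevelTrivial_charZeroDict V c hGR hGR₀ hGR₁ η hη hηc h₁W χ,
    hasRationalRestriction_charZeroDict_one_of_weight V c hGR hGR₀ hGR₁ η hη χ w hχw hw⟩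

end ThetaAdelicSide

end HodgeCM.Model

end
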